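import Mathlib
import HarnessLib
import Summits.Ventures.LatticeQCDFlow.Exactness.LatticeSitePolynomialLaplacian
import Summits.Ventures.LatticeQCDFlow.Exactness.SphereLatticePoissonSolver

/-!
# Existence of Lüscher's flow-action series `S̃ = Σ_k t^k S̃⁽ᵏ⁾` at all orders on the lattice of site spheres, polynomial order by order

HONEST FRAMING: exact (Metropolis-corrected) sampling algorithms for lattice gauge theory;
figures of merit are autocorrelation/cost numbers at stated couplings and volumes; no
continuum-physics claim.

Venture `LatticeQCDFlow` (cell pub-lqcd), topic `Exactness`; FANOUT row 7 (`s0-cpn-null`: the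
S0-D1 rung — 2D CP⁹, Lüscher's LO trivializing map inside HMC, Engel–Schaefer 2011).  NEW WORK of
the cell over Mathlib and the tree's `Exactness/LatticeSitePolynomials.lean`,
`Exactness/LatticeSiteDerivatives.lean`, `Exactness/LatticeSitePolynomialLaplacian.lean` (the
lattice polynomials `polyS N`, stable under E–S's `Σ_k ∂̃_k·∂̃_k` on the spheres),
`Exactness/SphereLatticePoissonSolver.lean` (GEN-8: `−Σ_k ∂̃_k·∂̃_k X = R + c` is solvable in any
finite-dimensional `𝔏₀`-stable space of `C²` functionals containing the constants),
`Exactness/SphereLOFlowAction.lean` (`esAction`, `siteGrad`, `siteLaplacian`) and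
`Exactness/SphereTangentialLaplacian.lean` (`fderiv_comp_normalize`, E–S eq. (12)); nothing is
cited as a fact.  It is the sphere-model counterpart of theory-1's gauge-side
`TrivializingMaps/LuscherSeriesExistence.lean` (Wilson action, `SU(n)^E`).  Printed counterpart,
NAMED ONLY: M. Lüscher, Commun. Math. Phys. 293 (2010) 899, §3.3 eqs. (3.9)–(3.12) and §4.3–§4.4
eqs. (4.12)–(4.22) (the flow action `S̃_t` of a trivializing map solves
`𝔏_t S̃_t = S + Ċ_t`; expanding in `t`, `−Σ∂²S̃⁽⁰⁾ = S + ċ₀` and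
`−Σ∂²S̃⁽ᵏ⁺¹⁾ = −Σ⟨∂S, ∂S̃⁽ᵏ⁾⟩ + ċ_{k+1}`, each order solvable "by linear algebra" because `Δ`
preserves polynomials); Engel–Schaefer, Comput. Phys. Commun. 182 (2011) 2107, §3 eqs. (14)–(16)
(the same recursion for the CP(N−1)/O(N) site spheres, of which they implement order `0`).

## Content (`E` finite-dimensional real inner product space, `d = dim E ≥ 2`; `Λ` finite, nonempty)

* §1 THE CARRÉ DU CHAMP ON THE SPHERES IS POLYNOMIAL: `inner_siteGrad` (E–S eq. (12) paired:
  `⟪∂̃_k F, h⟫ = D_kF·h − ⟪x_k, h⟫ E_kF`), **`inner_siteGrad_siteGrad`**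
  (`⟪∂̃_k S, ∂̃_k X⟫ = Σ_i D_kS·b_i D_kX·b_i − E_kS · E_kX` on `‖x_k‖ = 1`), `ambCarre`,
  **`ambCarre_mem_polyS`** (`polyS a × polyS m → polyS (a + m)`), `latticeCarre`,
  `sum_inner_siteGrad_eq_latticeCarre`.
* §2 THE RECURSION: `exists_polyS_poisson` (the Poisson solver instantiated on `polyS N`),
  `solveP`/`solveP_spec`, `luscherRec` (order `0` from the action, order `k+1` from the source
  `−Σ_n ⟪∂̃_n S, ∂̃_n S̃⁽ᵏ⁾⟫`), `luscherTerm`, **`luscherTerm_mem`** (`S̃⁽ᵏ⁾ ∈ polyS (a(k+1))` for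
  an action of degree `a`), **`luscherTerm_zero_eq`**, **`luscherTerm_succ_eq`**.
* §3 **`exists_luscher_series`** — FOR EVERY LATTICE-POLYNOMIAL ACTION `S` OF DEGREE `≤ a` THERE
  ARE LATTICE POLYNOMIALS `S̃⁽ᵏ⁾` OF DEGREE `≤ a(k+1)` AND CONSTANTS `ċ_k` SOLVING LÜSCHER'S
  RECURSION ON THE PRODUCT OF UNIT SPHERES AT EVERY ORDER; **`esAction_mem_polyS`** (the E–S /
  lattice CP(N−1)–O(N) action is a lattice polynomial of degree `2`, for ANY couplings `U`) and
  **`exists_luscher_series_esAction`** (degrees `2(k+1)`); `luscher_series_esAction_order_zero` —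
  for E–S couplings (no self-coupling, adjoint pairs) the order-`0` term of ANY such series is
  `S/(2(d−1))` up to an additive constant and `ċ₀ = −S₀` (tree: `loFlowAction_unique`).

Orders `0` and `1` are in closed form in the tree (`SphereLOFlowAction`, `SphereNLOFlowAction`);
each order is unique up to an additive constant (`SphereLatticeLuscherKernel.luscher_poisson_unique`)
and obeys the volume-uniform `L²` bound of `SphereLatticeLuscherStability`.

NOT CLAIMED: convergence of `Σ_k t^k S̃⁽ᵏ⁾` or any statement at `t > 0` (existence of the
trivializing map itself); locality / footprint growth of `S̃⁽ᵏ⁾` (theory-1 proves linear footprint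
growth on the gauge side; not attempted here); closed forms beyond order `1`; anything quantitative.
-/

noncomputable section

namespace Summit.Ventures.LatticeQCDFlow.Exactness

open Function Set NormedSpace InnerProductSpace Metric
open scoped RealInnerProductSpace ContDiff Gradient

variable {Λ : Type*} {E : Type*} [NormedAddCommGroup E] [InnerProductSpace ℝ E]

/-! ## §1 The carré du champ `⟪∂̃_k S, ∂̃_k X⟫` on the spheres is polynomial -/

section Carre

variable [FiniteDimensional ℝ E] [Fintype Λ] [DecidableEq Λ]

omit [Fintype Λ] in
/-- **E–S eq. (12), paired**: on `‖x k‖ = 1`, `⟪∂̃_k F(x), h⟫ = D_k F(x) h − ⟪x_k, h⟫ · E_k F(x)` —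
the natural gradient is the tangential projection of the site gradient. -/
theorem inner_siteGrad {F : (Λ → E) → ℝ} {x : Λ → E} {k : Λ} (hx : ‖x k‖ = 1)
    (hF : DifferentiableAt ℝ (fun y => F (update x k y)) (x k)) (h : E) :
    ⟪siteGrad k F x, h⟫ = siteDeriv k h F x - ⟪x k, h⟫ * siteEuler k F x := by
  unfold siteGrad
  rw [gradient, toDual_symm_apply]
  show fderiv ℝ (fun y => (fun y' => F (update x k y')) (normalize y)) (x k) h = _
  rw [fderiv_comp_normalize hx hF h, map_sub, map_smul, smul_eq_mul]
  rfl

omit [Fintype Λ] in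
/-- The natural gradient is tangent: `⟪x_k, ∂̃_k F(x)⟫ = 0` on `‖x k‖ = 1`. -/
theorem inner_self_siteGrad {F : (Λ → E) → ℝ} {x : Λ → E} {k : Λ} (hx : ‖x k‖ = 1)
    (hF : DifferentiableAt ℝ (fun y => F (update x k y)) (x k)) : ⟪x k, siteGrad k F x⟫ = 0 := by
  rw [real_inner_comm, inner_siteGrad hx hF, real_inner_self_eq_norm_sq, hx]
  simp [siteEuler]

omit [Fintype Λ] in
/-- A site derivative along an arbitrary vector, expanded in the frame:
`D_k F(x) v = Σ_i ⟪b i, v⟫ · D_k F(x) (b i)`. -/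
theorem siteDeriv_eq_sum (k : Λ) (v : E) (F : (Λ → E) → ℝ) (x : Λ → E) :
    siteDeriv k v F x = ∑ i, ⟪stdOrthonormalBasis ℝ E i, v⟫ *
      siteDeriv k (stdOrthonormalBasis ℝ E i) F x := by
  unfold siteDeriv
  set L := fderiv ℝ (fun y => F (update x k y)) (x k)
  calc L v = L (∑ i, ⟪stdOrthonormalBasis ℝ E i, v⟫ • stdOrthonormalBasis ℝ E i) := by
        rw [(stdOrthonormalBasis ℝ E).sum_repr']
    _ = ∑ i, ⟪stdOrthonormalBasis ℝ E i, v⟫ * L (stdOrthonormalBasis ℝ E i) := by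
        simp only [map_sum, map_smul, smul_eq_mul]

omit [Fintype Λ] in
/-- **THE CARRÉ DU CHAMP ON THE SPHERE, in ambient terms**: on `‖x k‖ = 1`,
`⟪∂̃_k S(x), ∂̃_k X(x)⟫ = Σ_i D_kS(x)b_i · D_kX(x)b_i − E_kS(x) · E_kX(x)`
(`⟪P∇g_S, P∇g_X⟫ = ⟪∇g_S, ∇g_X⟫ − (∇g_S·u)(∇g_X·u)` for the tangential projection `P` at `u = x_k`). -/
theorem inner_siteGrad_siteGrad {S X : (Λ → E) → ℝ} {x : Λ → E} {k : Λ} (hx : ‖x k‖ = 1)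
    (hS : DifferentiableAt ℝ (fun y => S (update x k y)) (x k))
    (hX : DifferentiableAt ℝ (fun y => X (update x k y)) (x k)) :
    ⟪siteGrad k S x, siteGrad k X x⟫ =
      (∑ i, siteDeriv k (stdOrthonormalBasis ℝ E i) S x * siteDeriv k (stdOrthonormalBasis ℝ E i) X x) -
        siteEuler k S x * siteEuler k X x := by
  have h0 : ⟪x k, siteGrad k X x⟫ = 0 := inner_self_siteGrad hx hX
  have hV : ∀ i, ⟪stdOrthonormalBasis ℝ E i, siteGrad k X x⟫ =
      siteDeriv k (stdOrthonormalBasis ℝ E i) X x -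
        ⟪x k, stdOrthonormalBasis ℝ E i⟫ * siteEuler k X x :=
    fun i => by rw [real_inner_comm, inner_siteGrad hx hX]
  rw [inner_siteGrad hx hS, h0, zero_mul, sub_zero, siteDeriv_eq_sum]
  simp_rw [hV, sub_mul, Finset.sum_sub_distrib]
  rw [siteEuler_eq_sum k S x]
  simp only [scoord, Finset.sum_mul]
  congr 1
  · exact Finset.sum_congr rfl fun i _ => by ring
  · exact Finset.sum_congr rfl fun i _ => by rw [real_inner_comm (x k)]; ring

/-- **The ambient carré du champ at site `k`**:
`ambCarre k S X = Σ_i D_kS·b_i · D_kX·b_i − E_kS · E_kX` (a function on `Λ → E`). -/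
def ambCarre (k : Λ) (S X : (Λ → E) → ℝ) : (Λ → E) → ℝ := fun x =>
  (∑ i, siteDeriv k (stdOrthonormalBasis ℝ E i) S x * siteDeriv k (stdOrthonormalBasis ℝ E i) X x) -
    siteEuler k S x * siteEuler k X x

/-- **The lattice carré du champ** `Σ_k ambCarre k S X`. -/
def latticeCarre (S X : (Λ → E) → ℝ) : (Λ → E) → ℝ := fun x => ∑ k, ambCarre k S X x

omit [Fintype Λ] in
/-- On `‖x k‖ = 1`, `⟪∂̃_k S, ∂̃_k X⟫ = ambCarre k S X` (smooth `S`, `X`). -/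
theorem inner_siteGrad_siteGrad_eq_ambCarre [Fintype Λ] {S X : (Λ → E) → ℝ} (hS : ContDiff ℝ ∞ S)
    (hX : ContDiff ℝ ∞ X) {x : Λ → E} {k : Λ} (hx : ‖x k‖ = 1) :
    ⟪siteGrad k S x, siteGrad k X x⟫ = ambCarre k S X x :=
  inner_siteGrad_siteGrad hx (differentiableAt_section hS x k _) (differentiableAt_section hX x k _)

/-- **On the product of unit spheres, `Σ_k ⟪∂̃_k S, ∂̃_k X⟫ = latticeCarre S X`.** -/
theorem sum_inner_siteGrad_eq_latticeCarre {S X : (Λ → E) → ℝ} (hS : ContDiff ℝ ∞ S)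
    (hX : ContDiff ℝ ∞ X) {x : Λ → E} (hx : ∀ k, ‖x k‖ = 1) :
    ∑ k, ⟪siteGrad k S x, siteGrad k X x⟫ = latticeCarre S X x :=
  Finset.sum_congr rfl fun k _ => inner_siteGrad_siteGrad_eq_ambCarre hS hX (hx k)

/-- **The carré du champ is graded**: `S ∈ polyS a`, `X ∈ polyS m` ⇒ `ambCarre k S X ∈ polyS (a+m)`. -/
theorem ambCarre_mem_polyS (k : Λ) {a m : ℕ} {S X : (Λ → E) → ℝ} (hS : S ∈ polyS Λ E a)
    (hX : X ∈ polyS Λ E m) : ambCarre k S X ∈ polyS Λ E (a + m) := by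
  have e : ambCarre k S X = (∑ i, siteDeriv k (stdOrthonormalBasis ℝ E i) S *
      siteDeriv k (stdOrthonormalBasis ℝ E i) X) - siteEuler k S * siteEuler k X := by
    funext x; simp only [ambCarre, Pi.sub_apply, Finset.sum_apply, Pi.mul_apply]
  rw [e]
  refine Submodule.sub_mem _ (Submodule.sum_mem _ fun i _ => ?_) ?_
  · exact mul_mem_polyS_of_le (by omega) (siteDeriv_mem_polyS k _ hS) (siteDeriv_mem_polyS k _ hX)
  · exact mul_mem_polyS_of_le le_rfl (siteEuler_mem_polyS k hS) (siteEuler_mem_polyS k hX)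

/-- `latticeCarre S X ∈ polyS (a + m)`, and so is its negative (the source of the next order). -/
theorem neg_latticeCarre_mem_polyS {a m : ℕ} {S X : (Λ → E) → ℝ} (hS : S ∈ polyS Λ E a)
    (hX : X ∈ polyS Λ E m) : (fun x => -latticeCarre S X x) ∈ polyS Λ E (a + m) := by
  have e : (fun x => -latticeCarre S X x) = -∑ k, ambCarre k S X := by
    funext x; simp only [latticeCarre, Pi.neg_apply, Finset.sum_apply]
  rw [e]
  exact Submodule.neg_mem _ (Submodule.sum_mem _ fun k _ => ambCarre_mem_polyS k hS hX)

end Carre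

/-! ## §2 The recursion: solve order by order inside the lattice polynomials -/

section Recursion

variable [FiniteDimensional ℝ E] [MeasurableSpace E] [BorelSpace E] [Fintype Λ] [DecidableEq Λ]
  [Nonempty Λ]

/-- **The Poisson solver on `polyS N`**: for every lattice polynomial `R` of degree `≤ N` there are
a lattice polynomial `X` of degree `≤ N` and a constant `c` with `−Σ_k ∂̃_k·∂̃_k X = R + c` on the
product of unit spheres (`SphereLatticePoissonSolver.exists_luscher_poisson_solution`, all of whose
hypotheses the lattice polynomials meet). -/
theorem exists_polyS_poisson (h2 : 2 ≤ Module.finrank ℝ E) {N : ℕ} {R : (Λ → E) → ℝ}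
    (hR : R ∈ polyS Λ E N) :
    ∃ X : polyS Λ E N, ∃ c : ℝ, ∀ ξ : Λ → sphere (0 : E) 1,
      -∑ k, siteLaplacian k (X : (Λ → E) → ℝ) (fun n => (ξ n : E)) = R (fun n => (ξ n : E)) + c := by
  obtain ⟨X, hXP, c, hc⟩ := exists_luscher_poisson_solution h2 (polyS_contDiff_two N)
    (polyS_siteLaplacian_stable N) (one_mem_polyS N) hR
  exact ⟨⟨X, hXP⟩, c, hc⟩

/-- A chosen solution `X ∈ polyS N` of `−Σ_k ∂̃_k·∂̃_k X = R + c`. -/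
def solveP (h2 : 2 ≤ Module.finrank ℝ E) {N : ℕ} {R : (Λ → E) → ℝ} (hR : R ∈ polyS Λ E N) :
    polyS Λ E N :=
  Classical.choose (exists_polyS_poisson h2 hR)

/-- The defining property of `solveP`. -/
theorem solveP_spec (h2 : 2 ≤ Module.finrank ℝ E) {N : ℕ} {R : (Λ → E) → ℝ}
    (hR : R ∈ polyS Λ E N) : ∃ c : ℝ, ∀ ξ : Λ → sphere (0 : E) 1,
      -∑ k, siteLaplacian k (solveP h2 hR : (Λ → E) → ℝ) (fun n => (ξ n : E)) =
        R (fun n => (ξ n : E)) + c :=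
  Classical.choose_spec (exists_polyS_poisson h2 hR)

/-- **Lüscher's recursion inside the lattice polynomials** for an action `S ∈ polyS a`: order `0`
solves `−Σ∂̃²S̃⁽⁰⁾ = S + ċ₀`; order `k+1` solves `−Σ∂̃²S̃⁽ᵏ⁺¹⁾ = −latticeCarre S S̃⁽ᵏ⁾ + ċ_{k+1}`;
the degree is carried along (`a`, then `a +` the previous degree). -/
def luscherRec (h2 : 2 ≤ Module.finrank ℝ E) {a : ℕ} {S : (Λ → E) → ℝ} (hS : S ∈ polyS Λ E a) :
    ℕ → Σ N : ℕ, polyS Λ E N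
  | 0 => ⟨a, solveP h2 hS⟩
  | k + 1 => ⟨a + (luscherRec h2 hS k).1,
      solveP h2 (neg_latticeCarre_mem_polyS hS (luscherRec h2 hS k).2.2)⟩

/-- **The order-`k` flow action `S̃⁽ᵏ⁾`** of the recursion. -/
def luscherTerm (h2 : 2 ≤ Module.finrank ℝ E) {a : ℕ} {S : (Λ → E) → ℝ} (hS : S ∈ polyS Λ E a)
    (k : ℕ) : (Λ → E) → ℝ :=
  ((luscherRec h2 hS k).2 : (Λ → E) → ℝ)

/-- The degree carried at order `k` is `a(k+1)`. -/
theorem luscherRec_fst (h2 : 2 ≤ Module.finrank ℝ E) {a : ℕ} {S : (Λ → E) → ℝ}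
    (hS : S ∈ polyS Λ E a) : ∀ k, (luscherRec h2 hS k).1 = a * (k + 1)
  | 0 => by simp [luscherRec]
  | k + 1 => by
      show a + (luscherRec h2 hS k).1 = a * (k + 1 + 1)
      rw [luscherRec_fst h2 hS k]; ring

/-- **`S̃⁽ᵏ⁾` is a lattice polynomial of degree `≤ a(k+1)`.** -/
theorem luscherTerm_mem (h2 : 2 ≤ Module.finrank ℝ E) {a : ℕ} {S : (Λ → E) → ℝ}
    (hS : S ∈ polyS Λ E a) (k : ℕ) : luscherTerm h2 hS k ∈ polyS Λ E (a * (k + 1)) :=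
  polyS_mono (le_of_eq (luscherRec_fst h2 hS k)) (luscherRec h2 hS k).2.2

/-- `S̃⁽ᵏ⁾` is smooth. -/
theorem contDiff_luscherTerm (h2 : 2 ≤ Module.finrank ℝ E) {a : ℕ} {S : (Λ → E) → ℝ}
    (hS : S ∈ polyS Λ E a) (k : ℕ) : ContDiff ℝ ∞ (luscherTerm h2 hS k) :=
  contDiff_of_mem_polyS (luscherTerm_mem h2 hS k)

/-- **Order `0`**: `−Σ_n ∂̃_n·∂̃_n S̃⁽⁰⁾ = S + ċ₀` on the product of unit spheres. -/
theorem luscherTerm_zero_eq (h2 : 2 ≤ Module.finrank ℝ E) {a : ℕ} {S : (Λ → E) → ℝ}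
    (hS : S ∈ polyS Λ E a) : ∃ c : ℝ, ∀ ξ : Λ → sphere (0 : E) 1,
      -∑ n, siteLaplacian n (luscherTerm h2 hS 0) (fun m => (ξ m : E)) =
        S (fun m => (ξ m : E)) + c :=
  solveP_spec h2 hS

/-- **Order `k+1`**: `−Σ_n ∂̃_n·∂̃_n S̃⁽ᵏ⁺¹⁾ = −Σ_n ⟪∂̃_n S, ∂̃_n S̃⁽ᵏ⁾⟫ + ċ_{k+1}` on the product
of unit spheres. -/
theorem luscherTerm_succ_eq (h2 : 2 ≤ Module.finrank ℝ E) {a : ℕ} {S : (Λ → E) → ℝ}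
    (hS : S ∈ polyS Λ E a) (k : ℕ) : ∃ c : ℝ, ∀ ξ : Λ → sphere (0 : E) 1,
      -∑ n, siteLaplacian n (luscherTerm h2 hS (k + 1)) (fun m => (ξ m : E)) =
        -(∑ n, ⟪siteGrad n S (fun m => (ξ m : E)),
            siteGrad n (luscherTerm h2 hS k) (fun m => (ξ m : E))⟫) + c := by
  obtain ⟨c, hc⟩ := solveP_spec h2 (neg_latticeCarre_mem_polyS hS (luscherRec h2 hS k).2.2)
  refine ⟨c, fun ξ => ?_⟩
  rw [sum_inner_siteGrad_eq_latticeCarre (contDiff_of_mem_polyS hS) (contDiff_luscherTerm h2 hS k)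
    fun n => by simp]
  exact hc ξ

end Recursion

/-! ## §3 Existence at all orders; the Engel–Schaefer action -/

section Existence

variable [FiniteDimensional ℝ E] [MeasurableSpace E] [BorelSpace E] [Fintype Λ] [DecidableEq Λ]

/-- **EXISTENCE OF LÜSCHER'S FLOW-ACTION SERIES AT ALL ORDERS, POLYNOMIAL ORDER BY ORDER.**  On the
lattice `S(E)^Λ` of unit spheres (`dim E ≥ 2`, `Λ` finite nonempty), every lattice-polynomial
action `S` of degree `≤ a` admits lattice polynomials `S̃⁽ᵏ⁾` of degree `≤ a(k+1)` and constants
`ċ_k` with `−Σ_n ∂̃_n·∂̃_n S̃⁽⁰⁾ = S + ċ₀` and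
`−Σ_n ∂̃_n·∂̃_n S̃⁽ᵏ⁺¹⁾ = −Σ_n ⟪∂̃_n S, ∂̃_n S̃⁽ᵏ⁾⟫ + ċ_{k+1}` for all `k`. -/
theorem exists_luscher_series [Nonempty Λ] (h2 : 2 ≤ Module.finrank ℝ E) {a : ℕ}
    {S : (Λ → E) → ℝ} (hS : S ∈ polyS Λ E a) :
    ∃ (St : ℕ → (Λ → E) → ℝ) (c : ℕ → ℝ),
      (∀ k, St k ∈ polyS Λ E (a * (k + 1))) ∧
      (∀ ξ : Λ → sphere (0 : E) 1,
        -∑ n, siteLaplacian n (St 0) (fun m => (ξ m : E)) = S (fun m => (ξ m : E)) + c 0) ∧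
      (∀ k, ∀ ξ : Λ → sphere (0 : E) 1,
        -∑ n, siteLaplacian n (St (k + 1)) (fun m => (ξ m : E)) =
          -(∑ n, ⟪siteGrad n S (fun m => (ξ m : E)), siteGrad n (St k) (fun m => (ξ m : E))⟫) +
            c (k + 1)) := by
  refine ⟨luscherTerm h2 hS, fun k => Nat.casesOn k (Classical.choose (luscherTerm_zero_eq h2 hS))
    fun j => Classical.choose (luscherTerm_succ_eq h2 hS j), luscherTerm_mem h2 hS,
    Classical.choose_spec (luscherTerm_zero_eq h2 hS), fun k => ?_⟩
  exact Classical.choose_spec (luscherTerm_succ_eq h2 hS k)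

omit [MeasurableSpace E] [BorelSpace E] [DecidableEq Λ] in
/-- **The Engel–Schaefer / lattice CP(N−1)–O(N) action is a lattice polynomial of degree `2`**
(`S = −κ Σ_n ⟪x_n, Σ_m U_{nm} x_m⟫ + S₀`, for ANY couplings `U`). -/
theorem esAction_mem_polyS (κ S₀ : ℝ) (U : Λ → Λ → (E →L[ℝ] E)) :
    esAction κ S₀ U ∈ polyS Λ E 2 := by
  set b := stdOrthonormalBasis ℝ E
  have e : esAction κ S₀ U = (-κ) • (∑ n, ∑ m, ∑ i, (scoord ((n, i) : SiteCoord Λ E) *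
      fun x : Λ → E => ⟪ContinuousLinearMap.adjoint (U n m) (b i), x m⟫)) + fun _ => S₀ := by
    funext x
    simp only [esAction, localField, Pi.add_apply, Pi.smul_apply, Finset.sum_apply, Pi.mul_apply,
      scoord, smul_eq_mul, inner_sum, ContinuousLinearMap.adjoint_inner_left]
    congr 1
    congr 1
    refine Finset.sum_congr rfl fun n _ => Finset.sum_congr rfl fun m _ => ?_
    rw [← b.sum_inner_mul_inner (x n) (U n m (x m))]
    exact Finset.sum_congr rfl fun i _ => by rw [real_inner_comm (b i)]
  rw [e]
  refine Submodule.add_mem _ (Submodule.smul_mem _ _ (Submodule.sum_mem _ fun n _ =>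
    Submodule.sum_mem _ fun m _ => Submodule.sum_mem _ fun i _ => ?_)) (const_mem_polyS 2 S₀)
  exact mul_mem_polyS_of_le (a := 1) (b := 1) le_rfl (scoord_mem_polyS le_rfl _)
    (slin_mem_polyS le_rfl m _)

/-- **LÜSCHER'S SERIES FOR THE ENGEL–SCHAEFER ACTION EXISTS AT ALL ORDERS**, with `S̃⁽ᵏ⁾` a lattice
polynomial of degree `≤ 2(k+1)` in the real site coordinates (any couplings `U`, `dim E ≥ 2`). -/
theorem exists_luscher_series_esAction [Nonempty Λ] (h2 : 2 ≤ Module.finrank ℝ E) (κ S₀ : ℝ)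
    (U : Λ → Λ → (E →L[ℝ] E)) :
    ∃ (St : ℕ → (Λ → E) → ℝ) (c : ℕ → ℝ),
      (∀ k, St k ∈ polyS Λ E (2 * (k + 1))) ∧
      (∀ ξ : Λ → sphere (0 : E) 1,
        -∑ n, siteLaplacian n (St 0) (fun m => (ξ m : E)) =
          esAction κ S₀ U (fun m => (ξ m : E)) + c 0) ∧
      (∀ k, ∀ ξ : Λ → sphere (0 : E) 1,
        -∑ n, siteLaplacian n (St (k + 1)) (fun m => (ξ m : E)) =
          -(∑ n, ⟪siteGrad n (esAction κ S₀ U) (fun m => (ξ m : E)),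
              siteGrad n (St k) (fun m => (ξ m : E))⟫) + c (k + 1)) :=
  exists_luscher_series h2 (esAction_mem_polyS κ S₀ U)

/-- **Order `0` of any such series is Engel–Schaefer's `S/(2(d−1))` up to a constant, with
`ċ₀ = −S₀`** (E–S couplings: no self-coupling, adjoint pairs; tree `loFlowAction_unique`). -/
theorem luscher_series_esAction_order_zero {U : Λ → Λ → (E →L[ℝ] E)} (hU0 : ∀ n, U n n = 0)
    (hUadj : ∀ m n (v w : E), ⟪U m n v, w⟫ = ⟪v, U n m w⟫) (h2 : 2 ≤ Module.finrank ℝ E)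
    (κ S₀ : ℝ) {St : ℕ → (Λ → E) → ℝ} {c : ℕ → ℝ} {N : ℕ} (hSt : St 0 ∈ polyS Λ E N)
    (h0 : ∀ ξ : Λ → sphere (0 : E) 1,
      -∑ n, siteLaplacian n (St 0) (fun m => (ξ m : E)) = esAction κ S₀ U (fun m => (ξ m : E)) + c 0) :
    c 0 = -S₀ ∧ ∀ ξ ξ' : Λ → sphere (0 : E) 1,
      St 0 (fun m => (ξ m : E)) - loFlowAction κ S₀ U (fun m => (ξ m : E)) =
        St 0 (fun m => (ξ' m : E)) - loFlowAction κ S₀ U (fun m => (ξ' m : E)) :=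
  loFlowAction_unique hU0 hUadj h2 κ S₀ (contDiff_infty.1 (contDiff_of_mem_polyS hSt) 2) h0

end Existence

end Summit.Ventures.LatticeQCDFlow.Exactness

end
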